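import Summits.HodgeConjecture.HodgeConjecture.Theorems.VHCAbelianSchemesRoadServedFibreDefs
import Summits.Ventures.HSemireg.AmplificationChainSigmaGluable
import Literature.AlgebraicGeometry.HodgeTheory.SemiregularVariationalHodgeTwistedPerfect
import HarnessLib

/-!
# Road b02 (`VHCAbelianSchemesRoad`, D-0059) — THE SECANT-ANCHOR INSTANCE of the served-fibre partition at `(6, 3)` (definitions only)

research route conditional on HC_CM; not a corollary; Q11.4-sentence-2 already refuted in dim ≥ 3.

DEFINITIONS ONLY (nothing asserted, nothing proved, `HC_CM` absent). The served-fibre partition of a cell (`…ServedFibreDefs`, ab-andre-2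
PART AA: `LefAtExceptionalRegimeAtUnder`, `HasServedFibre n p 𝔄 𝔖`, `AnchoredCarrierAt 𝒪 n p 𝔄 𝔖`) takes an ANCHOR PREDICATE `𝔄` and a
SERVED-CLASS MAP `𝔖`. This file supplies the instance the `(6, 3)` rung of crux stmt-HodgeConjecture-19787 is cut along (director-hodge g6/g7
RE-CUT (a′)/(a″)/(b′), ring2 LEAD gen 151 nod N1–N8 and ruling L151.4, seat b02 gen 86 finding F4), in TWO layers:

* §1 DOOR-GENERIC, OUTPUT-LEVEL anchor data of a cell `(n, p)` for an object class `𝒪`: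
  `pinnedOffRayClassesAt 𝒪 n p X θ` — the degree-`p` classes `v ∉ ℂ·θᵖ` that ARE the `p`-th class of a PINNED `𝒪`-datum on `X`
  (`(I ∋ p, κ)` admissible for `𝒪` ON `X`, `κ_p = v`, every side component on the `θ`-ray `κ_q = c_q·θ^q`);
  `carrierAnchorClassesAt 𝒪 n p X` — the classes `θ ∈ H²(X(ℂ); ℂ)` at which such a datum exists («`(X, θ)` carries a pinned `𝒪`-carrier
  off the Lefschetz ray»); `carrierServedClassesAt 𝒪 n p X θ` — the union of the PLANES `ℂ·θᵖ + ℂ·v` over those `v` (the classes `w` a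
  single such datum serves after rescaling, `κ_p = a·w + c·θᵖ`, `a ≠ 0`; the ray itself is served by null data when `𝒪` has them).
* §2 THE `(6, 3)` TWISTED INSTANCE (the crux's door `twistedReflexiveClass C AdmTw`, `AdmTw := gluableSigmaAdmissible ∨ bfSingleAdmissible`,
  spelled out): `secantAnchorSixfold C X`, `secantServedClasses C X θ` (names fixed by the cell's bus, director-hodge g7 2026-08-27T03:52:41Z),
  and the three statements `AnchorCarrier63 C` (anchored carrier), `ThroughSecantAnchor63 C` (the rung on pencils WITH a served fibre),
  `Residual63 C` (the rung on pencils with NO served fibre) — one-line instantiations of PART AA's constants.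

## FINDING F4 (why the anchor predicate is OUTPUT-level and not Markman's geometric anchor) — recorded for the tribunal (T2) and the card

The only printed carriers of the `(6, 3)` cell are Markman's: for `d` even `≥ 4`, the descended semiregular reflexive sheaf `𝓔̄` on the QUOTIENT
`Y_d = (Pic²(C) × Pic²(C)^)/Ḡ` (`C` a generic non-hyperelliptic genus-3 curve, `Ḡ ≅ (ℤ/(d+1))²` the Rouquier image of `G₁ × G₂`), polarised by
the descent `h` of the `Spin(V)_P`-invariant ample class, with `κ(𝓔̄) ∈ ℚ[h] ⊕ ℚγ`, `γ ≠ 0` Weil (arXiv:2502.03415 Thm. 1.4.1, §1.5, Cor. 4.0.4,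
Remark 9.3.7, Lemma 9.3.11; «the sheaf `𝓔` [on `X × X̂`] is not semiregular»). (i) The VERBATIM anchor predicate «`(X, θ) ≅ (Y_d, h)`» is NOT
TYPABLE on current carriers (no principally polarised threefold / genus-3 Jacobian with its polarisation, no dual abelian variety / Poincaré
class, no quotient by a finite subgroup at scheme level; typer debt `LEAD/ASK#carriers-secant-anchor`). (ii) Every typable GEOMETRIC surrogate
(split Weil sixfold of discriminant `-1`; isogenous to `B × B̂`; a quotient by SOME `(ℤ/(d+1))²`) is BROADER than print's anchor set, so an
anchored-carrier statement over it is not a statement the source proves. (iii) The only sound typable anchors are OUTPUT-level, as here; then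
the anchored carrier statement `AnchorCarrier63 C` is a FACT-FREE THEOREM (companion file `…SecantAnchor`: rescale the datum off the ray, null
datum on the ray), `Residual63 C ↔` the rung is FACT-FREE, and the PREPRINT is load-bearing exactly for INHABITATION of the anchor set —
`Literature.AlgebraicGeometry.HodgeTheory.Markman2025_secantQuotientAnchor_twistedCarrier_sixfold` (∃-shape, UNREFEREED) gives, for every even
`d ≥ 4`, a polarised sixfold `(Y, h)` with `h ∈ secantAnchorSixfold C Y` and a 2-plane `ℂh³ + ℂγ ⊆ secantServedClasses C Y h`. Consequently
(LEAD ruling L151.4) the skeleton of record stays v2 (`stub_rung_sixfoldMiddleTw`); this instance is landed as HELPERS `--supports` 19787 and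
the card names the rung's first proved sub-regime «pencils through a fibre carrying a Markman-shaped pinned twisted datum serving `W|`».

All `Set`-valued declarations are DATA; the three `Prop`s of §2 are statements — `AnchorCarrier63`/`ThroughSecantAnchor63` PROVED in the
companion file, `Residual63` OPEN (equivalent to the rung) — tagged `@[conjecture]` like the cells. Nothing here says any of them, any cell,
K-SR♭∃, VHC, `HC_AV` or HC holds. References: [cite: Bloch1972Semiregularity, Remark (7.5)] [cite: Markman2025SecantWeil, Thm. 1.4.1, §1.5 and
Cor. 4.0.4] [cite: vanGeemen1994HodgeAV, §2.4 and Thm. 4.11] [cite: BuchweitzFlenner2003, §5 Thm. 5.1].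
-/

noncomputable section

open CategoryTheory CategoryTheory.Limits AlgebraicGeometry Topology

namespace Summit.HodgeConjecture.HodgeConjecture.Ring2.SemiregularRepresentatives

-- the cell's namespace repeats the summit name (`Summit.HodgeConjecture.HodgeConjecture…`), as in every `Ring2*` file
set_option linter.dupNamespace false

open Literature.AlgebraicGeometry Literature.AlgebraicGeometry.Motives
open Literature.AlgebraicGeometry.HodgeTheory
open Literature.AlgebraicTopology.SingularHomology
open Literature.Barriers.HodgeConjecture (divisorClassesSpan)
open Summit.Ventures.HSemireg (ObjClass)

/-! ## §1 Door-generic OUTPUT-level anchor data of a cell `(n, p)` -/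

/-- **The off-ray pinned classes of `(X, θ)` for the door `𝒪` at `(n, p)` (`pinnedOffRayClassesAt 𝒪 n p X θ`)**: the classes
`v ∈ H^{2p}(X(ℂ); ℂ)` OFF the Lefschetz ray `ℂ·θᵖ` for which there are degrees `I ∋ p`, classes `κ` admissible for `𝒪` ON `X` and scalars
`c_q` with `κ_p = v` and `κ_q = c_q·θ^q` for `q ∈ I`, `q ≠ p` — the `p`-th classes of the PINNED `𝒪`-data at `(X, θ)` (Bloch's shape
`a·z₀ + b·l₀ᵖ` with all side components on the polarisation ray). DATA; empty unless `(X, θ)` carries such a datum. In Markman's instance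
(`𝒪 =` the twisted door, `(n, p) = (6, 3)`, `(X, θ) = (Y_d, h)`): `v = κ₃(𝓔̄) = γ + c₃·h³`. [cite: Bloch1972Semiregularity, Remark (7.5)]
[cite: Markman2025SecantWeil, §1.5 and Cor. 4.0.4] -/
def pinnedOffRayClassesAt (𝒪 : ObjClass) (n p : ℕ) (X : SchemeOver ℂ) (θ : complexBetti X 2) : Set (complexBetti X (2 * p)) :=
  {v | v ∉ (ℂ ∙ cupPowTwo θ p) ∧
    ∃ (I : Finset ℕ) (κ : (q : ℕ) → complexBetti X (2 * q)) (c : ℕ → ℂ),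
      p ∈ I ∧ 𝒪 n X I κ ∧ κ p = v ∧ ∀ q ∈ I, q ≠ p → κ q = c q • cupPowTwo θ q}

/-- **The carrier-anchor classes of `X` for the door `𝒪` at `(n, p)` (`carrierAnchorClassesAt 𝒪 n p X`)**: the classes `θ ∈ H²(X(ℂ); ℂ)`
such that `(X, θ)` carries a pinned `𝒪`-datum with `p`-th class OFF `ℂ·θᵖ` (`pinnedOffRayClassesAt 𝒪 n p X θ ≠ ∅`). The OUTPUT-LEVEL anchor
predicate of the served-fibre partition (finding F4, module docstring: the geometric anchor is untypable, every geometric surrogate unsound).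
DATA. [cite: Bloch1972Semiregularity, Remark (7.5)] [cite: Markman2025SecantWeil, Thm. 1.4.1 and §1.5] -/
def carrierAnchorClassesAt (𝒪 : ObjClass) (n p : ℕ) (X : SchemeOver ℂ) : Set (complexBetti X 2) :=
  {θ | (pinnedOffRayClassesAt 𝒪 n p X θ).Nonempty}

/-- **The served classes of `(X, θ)` for the door `𝒪` at `(n, p)` (`carrierServedClassesAt 𝒪 n p X θ`)**: the union, over the off-ray pinned
classes `v`, of the planes `ℂ·θᵖ + ℂ·v ⊆ H^{2p}(X(ℂ); ℂ)` — exactly the classes `w` served by ONE pinned datum after rescaling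
(`κ_p = a·w + c_p·θᵖ`, `a ≠ 0`, for `w` off the ray; the ray by null data). HONEST served set of finding F1 (ring2 LEAD gen 151): a union of
planes, NOT their span — direct sums of semiregular objects are not semiregular, so `ℚ`-combinations of served directions are not served.
DATA. [cite: Bloch1972Semiregularity, Remark (7.5)] [cite: Markman2025SecantWeil, Thm. 1.4.1 (4th item)] -/
def carrierServedClassesAt (𝒪 : ObjClass) (n p : ℕ) (X : SchemeOver ℂ) (θ : complexBetti X 2) : Set (complexBetti X (2 * p)) :=
  ⋃ v ∈ pinnedOffRayClassesAt 𝒪 n p X θ, (Submodule.span ℂ {cupPowTwo θ p, v} : Set (complexBetti X (2 * p)))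

/-! ## §2 The `(6, 3)` twisted instance: secant anchors, served classes, and the three statements of the re-cut -/

/-- **`secantAnchorSixfold C X` — the SECANT-ANCHOR CLASSES of `X` (OUTPUT-level; finding F4)**: the classes `θ ∈ H²(X(ℂ); ℂ)` at which `X`
carries a PINNED datum of the crux's twisted door `twistedReflexiveClass C AdmTw` at `(6, 3)` — a `B`-twisted `AdmTw`-admissible bounded
complex of vector bundles ON `X` with `κ₃ ∉ ℂ·θ³` and `κ_q = c_q·θ^q` off degree `3` — i.e. `carrierAnchorClassesAt (tw C AdmTw) 6 3 X`.
«Markman-SHAPED», not «Markman's»: the verbatim anchor `(Y_d = (Pic²(C) × Pic²(C)^)/Ḡ, h)` is untypable on current carriers (module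
docstring (i)–(iii)); that it BELONGS here for every even `d ≥ 4` is the PREPRINT's content
(`Markman2025_secantQuotientAnchor_twistedCarrier_sixfold`, companion file). DATA. [cite: Markman2025SecantWeil, Thm. 1.4.1, §1.5 and Cor. 4.0.4]
[cite: Bloch1972Semiregularity, Remark (7.5)] -/
def secantAnchorSixfold (C : ChernCharacterBetti) (X : SchemeOver ℂ) : Set (complexBetti X 2) :=
  carrierAnchorClassesAt (Literature.AlgebraicGeometry.HodgeTheory.twistedReflexiveClass C
    (fun n X₀ I E => Summit.Ventures.HSemireg.gluableSigmaAdmissible n X₀ I E ∨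
      Literature.AlgebraicGeometry.HodgeTheory.bfSingleAdmissible n X₀ I E)) 6 3 X

/-- **`secantServedClasses C X θ` — the classes SERVED at a secant anchor `(X, θ)`** (finding F1's honest set): the union of the planes
`ℂ·θ³ + ℂ·κ₃` over the pinned twisted data at `(X, θ)` with `κ₃` off the ray — `carrierServedClassesAt (tw C AdmTw) 6 3 X θ`. In Markman's
instance ONE plane `ℂh³ + ℂγ` per construction (`γ` the Weil component of `κ₃(𝓔̄)`); the other rational directions of `ℚh³ ⊕ ĤW` are NOT
served in print (translates `η(k)^*` reach `k⁶·γ` only; sums of carriers are not carriers). DATA. [cite: Markman2025SecantWeil, Thm. 1.4.1 (4th item)]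
[cite: Bloch1972Semiregularity, Remark (7.5)] -/
def secantServedClasses (C : ChernCharacterBetti) (X : SchemeOver ℂ) (θ : complexBetti X 2) : Set (complexBetti X (2 * 3)) :=
  carrierServedClassesAt (Literature.AlgebraicGeometry.HodgeTheory.twistedReflexiveClass C
    (fun n X₀ I E => Summit.Ventures.HSemireg.gluableSigmaAdmissible n X₀ I E ∨
      Literature.AlgebraicGeometry.HodgeTheory.bfSingleAdmissible n X₀ I E)) 6 3 X θ

/-- **`AnchorCarrier63 C` — THE ANCHORED CARRIER STATEMENT of the `(6, 3)` cell over the secant anchors** (director-hodge (a′), LEAD N3):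
`AnchoredCarrierAt (tw C AdmTw) 6 3 secantAnchorSixfold secantServedClasses` — at every secant anchor `(X, θ)` and every served rational `w`, a
pinned twisted datum ON `X` with `κ₃ = a·w + c₃·θ³`, `a ≠ 0`, sides on the ray. With OUTPUT-level anchors this is a FACT-FREE THEOREM
(`anchorCarrier63`, companion file; finding F4 (iii)) — kept as a named statement because the line card cites it; the PREPRINT enters only
its non-vacuity. [cite: Bloch1972Semiregularity, Remark (7.5)] [cite: Markman2025SecantWeil, Thm. 1.4.1 and §1.5] -/
@[conjecture] def AnchorCarrier63 (C : ChernCharacterBetti) : Prop :=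
  AnchoredCarrierAt (Literature.AlgebraicGeometry.HodgeTheory.twistedReflexiveClass C
    (fun n X₀ I E => Summit.Ventures.HSemireg.gluableSigmaAdmissible n X₀ I E ∨
      Literature.AlgebraicGeometry.HodgeTheory.bfSingleAdmissible n X₀ I E)) 6 3
    (fun X θ => θ ∈ secantAnchorSixfold C X) (secantServedClasses C)

/-- **`ThroughSecantAnchor63 C` — THE `(6, 3)` RUNG ON THE PENCILS THROUGH A SERVED SECANT-ANCHOR FIBRE** (director-hodge (a″)): regime 2 of
K-SR♭∃ for the twisted door at `(6, 3)` UNDER `HasServedFibre 6 3 secantAnchorSixfold secantServedClasses` (some fibre `𝒳_{sₐ}`, polarised by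
the restriction of a GLOBAL fibrewise-rational `(1,1)` class `Θ`, carries a pinned twisted datum serving `W|_{sₐ}`). PROVED fact-free
(`throughSecantAnchor63`, companion file: PART Z-b §5 transport via PART AA); its range is INHABITED modulo the preprint — the rung's first proved
sub-regime. [cite: Bloch1972Semiregularity, Remark (7.5)] [cite: Markman2025SecantWeil, Thm. 1.4.1 and Thm. 1.5.1] [cite: VoisinHodgeI2002, §7.1.2] -/
@[conjecture] def ThroughSecantAnchor63 (C : ChernCharacterBetti) : Prop :=
  LefAtExceptionalRegimeAtUnder (Literature.AlgebraicGeometry.HodgeTheory.twistedReflexiveClass C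
    (fun n X₀ I E => Summit.Ventures.HSemireg.gluableSigmaAdmissible n X₀ I E ∨
      Literature.AlgebraicGeometry.HodgeTheory.bfSingleAdmissible n X₀ I E)) 6 3
    (HasServedFibre 6 3 (fun X θ => θ ∈ secantAnchorSixfold C X) (secantServedClasses C))

/-- **`Residual63 C` — THE `(6, 3)` RESIDUAL: the rung on the pencils with NO served secant-anchor fibre** (director-hodge (b′), LEAD N6):
the binders of `LefAtExceptionalRegimeSixfoldMiddle (tw C AdmTw)` VERBATIM (one-parameter abelian sixfold scheme over a smooth irreducible affine
curve with a section; `W` fibrewise rational `(3,3)`, algebraic at `s₀`, NOT algebraic-Lefschetz on every fibre) PLUS «no fibre, polarised by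
the restriction of any global fibrewise-rational `(1,1)` class, carries a pinned twisted datum serving `W|`»; same conclusion. The EXACT
complement of `ThroughSecantAnchor63 C` (excluded middle, PART AA) — no narrowing can hide; EQUIVALENT to the rung fact-free
(`residual63_iff_rung_sixfoldMiddleTw`, companion file), since its complement is proved. OPEN; a HYPOTHESIS wherever used. FINDING F2 (ab-andre-2
g58 / ring2 LEAD gen 151, preamble to the list): at the printed anchors `Y_d ~ J(C)²` (`C` generic: `MT = GSp₆`, Hodge ring of powers
divisor-generated) EVERY Hodge class is an algebraic LEFSCHETZ class, so the served class `γ` lies in `D³(Y_d) ⊗ ℂ` — the preprint's content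
is the semiregular DATUM at `Y_d` and (PART AA-b) its TRANSPORT to the exceptional fibres of pencils THROUGH `Y_d`, nothing AT the anchor;
in particular the constant pencil `Y_d × 𝔸¹` is NOT in regime 2, and a served pencil inside the cell's binders must be a genuine Weil-type
pencil through `Y_d` with a Néron–Severi-rank-one member (a displayed family-supply hypothesis, `Ring2.Hypotheses` shape). WHAT IT CONTAINS
(orientation only, none of it load-bearing; atlas/census words at filing time, cf. pub-hsemireg HEAD v4 477742abd6e51fb9):
(α) the SPLIT Weil-type sixfold pencils — every `K = ℚ(√-d)`, every discriminant, including the general pencil of the components of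
discriminant `-1` that CONTAIN Markman's anchors — through no fibre carrying a Markman-shaped datum (print: Weil classes ALGEBRAIC on split
components of discriminant `-1` by deformation + Baire from the anchor, arXiv:2502.03415 Thm. 1.5.1 = the tree's
`Markman2025_weilClasses_algebraic_hyperbolicSixfold`; NO carrier off the anchors; for `K = ℚ(i)`, `ℚ(√-2)` the anchors are those of `d = 4, 8`);
(β) the NON-SPLIT `(3, d, δ)` cells — the members of `Ring2.Hypotheses.WeilClassesComponent 3 d δ`, `δ ≠ [-1]` (class target OPEN in print);
general member = the LADDER's H2 object at `n = 3` in PART Z-e's words: an UNTWISTED `AdmTw`-complex of vector bundles with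
`ch₃ = a·w + c·θ³`, `a ≠ 0`, on a very general member (`exists_untwisted_pinned_sixfold_of_rung_sixfoldMiddleTw`);
(γ) the odd-rank PRODUCT sub-loci `{X₅ × Ē}`, `{X₃ × X̄₃′}`, `{X₃ × Ē² × E}` of the non-split cells over `ℚ(i)`/`ℚ(√-3)` (Abdulali 2012 Thm. 14,
REFEREED: class algebraic, carrier unknown);
(δ) CM cells (binder territory `(hCM : CMAbelianHodge)` only, never a fact) and type-III / product cells with their atlas status;
(ε) pencils through an anchor fibre whose class `W|` lies OFF the served planes `ℂθ³ + ℂκ₃` or whose polarisation `Θ|` is not an anchor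
class (findings F1/F3) — residual by `under_mono`.
Per-variety LOWER BOUND alongside (PART Z-c/Z-d): the rung, hence this residual ∧ `throughSecantAnchor63`, implies `DesignModLefschetzAt (tw C AdmTw) 6 3`
(`designModLefschetzAt_of_rung_sixfoldMiddleTw`; kill switch `not_rung_sixfoldMiddleTw_of_not_designModLefschetzAt`).
[cite: vanGeemen1994HodgeAV, §2.4 and Thm. 4.11] [cite: Markman2025SecantWeil, Thm. 1.4.1 and Thm. 1.5.1] [cite: Bloch1972Semiregularity, Remark (7.5)]
[cite: Abdulali2012TateTwistsIV, Thm. 14] -/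
@[conjecture] def Residual63 (C : ChernCharacterBetti) : Prop :=
  LefAtExceptionalRegimeAtUnder (Literature.AlgebraicGeometry.HodgeTheory.twistedReflexiveClass C
    (fun n X₀ I E => Summit.Ventures.HSemireg.gluableSigmaAdmissible n X₀ I E ∨
      Literature.AlgebraicGeometry.HodgeTheory.bfSingleAdmissible n X₀ I E)) 6 3
    (fun _ _ f W => ¬ HasServedFibre 6 3 (fun X θ => θ ∈ secantAnchorSixfold C X) (secantServedClasses C) f W)

end Summit.HodgeConjecture.HodgeConjecture.Ring2.SemiregularRepresentatives

end
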